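import Mathlib
import Literature.Analysis.FluidPDE.ClassicalSolution
import Literature.Analysis.FluidPDE.LerayHopf
import Literature.Analysis.FluidPDE.NSWave0
import Summits.NavierStokesRegularity.NavierStokesRegularity.Theorems.SlicedKelvinPlanarFluxAPrioriDecayLevels

/-!
# Crux `SlicedKelvin.PlanarFluxAPriori` (stmt-NavierStokesRegularity-15600), line `registered`,
# stub `stub_decayPersistence` — cubic spatial decay persists along the classical solution

Support file (theorems only; `--supports stmt-NavierStokesRegularity-15600`) proving the
registered stub `stub_decayPersistence` of the lead's skeleton: for `ν > 0`, a classical solution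
`(u, p)` of the unforced Navier–Stokes system on `ℝ³ × [0, T)` which is Leray–Hopf from its rapidly
decaying datum, and every `t < T`, the fields `u, Du, D²u, D³u` carry the cubic weight
`(1 + |x|)³` uniformly on `[0, t] × ℝ³` (Brandolese 2004; Kukavica–Torres 2006: space decay of
strong solutions; the order `3` is below the generic `|x|⁻⁴` of the velocity). The analytic work
is `decay_levels` (`…DecayLevels.lean`: Tao's bounds on closed slabs, the Oseen representation
from the initial time and its directional derivatives, the weighted bootstrap); here
`Dᵏ(u s)(x)(m) = ∂_{m₀}⋯∂_{m_{k-1}} u (s, x)` is read on unit vectors and the operator norm of the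
multilinear map `Dᵏ(u s)(x)` is bounded (`decay_opNorm_le_of_unit`). No named fact is assumed.

## References

* L. Brandolese, Math. Ann. 329 (2004) = arXiv:math/0403136.
* I. Kukavica, J. J. Torres, Nonlinearity 19 (2006).
* T. Tao, Anal. PDE 6 (2013), Cor. 11.1.
-/

noncomputable section

-- the summit and its single sub-problem share the name (CONVENTIONS §1), as in every Theorems file
set_option linter.dupNamespace false

namespace Summit.NavierStokesRegularity.NavierStokesRegularity.Theorems.SlicedKelvinPlanarFluxAPriori

open MeasureTheory Set Filter Topology Metric Real Function
open scoped ENNReal NNReal ContDiff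
open Literature.Analysis.FluidPDE Literature.Analysis.UnboundedOperators

/-- **stub `stub_decayPersistence` of the crux `SlicedKelvin.PlanarFluxAPriori`, line `registered`
(cubic spatial decay persists along the classical Leray–Hopf solution).** For `ν > 0`, a classical
solution `(u, p)` of the unforced Navier–Stokes system on `ℝ³ × [0, T)` which is Leray–Hopf from
its rapidly decaying datum, and every `t < T`, there is `C₀` with
`(1 + |x|)³ ‖Dᵏ(u s)(x)‖ ≤ C₀` for all `k ≤ 3`, `s ∈ [0, t]`, `x ∈ ℝ³` (Brandolese 2004;
Kukavica–Torres 2006; steps 1–4 of the module docstring, all ingredients proved in the tree). -/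
theorem stub_decayPersistence : ∀ (ν T : ℝ), 0 < ν → 0 < T → ∀ (u : ℝ → EuclideanSpace ℝ (Fin 3) → EuclideanSpace ℝ (Fin 3)) (p : ℝ → EuclideanSpace ℝ (Fin 3) → ℝ), Literature.Analysis.FluidPDE.IsClassicalNSSolutionOn (Set.Ico 0 T) ν 0 u p → Literature.Analysis.FluidPDE.IsLerayHopfOn T ν 0 (u 0) u → Literature.Analysis.FluidPDE.HasRapidSpatialDecay (u 0) → ∀ t ∈ Set.Ico 0 T, ∃ C₀ : ℝ, ∀ s ∈ Set.Icc 0 t, ∀ (x : EuclideanSpace ℝ (Fin 3)) (k : ℕ), k ≤ 3 → (1 + ‖x‖) ^ 3 * ‖iteratedFDeriv ℝ k (u s) x‖ ≤ C₀ := by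
  intro ν T hν hT u p hcl hLH hdec t ht
  -- the closed slab `[0, T₁]`, `t < T₁ < T`
  set T₁ : ℝ := (t + T) / 2 with hT₁
  have hT₁' : T₁ ∈ Ioo 0 T := ⟨by rw [hT₁]; linarith [ht.1, ht.2], by rw [hT₁]; linarith [ht.2]⟩
  have htT₁ : t ≤ T₁ := by rw [hT₁]; linarith [ht.2]
  obtain ⟨C, hC⟩ := decay_levels hν hcl hLH hdec hT₁'
  have hC0 : 0 ≤ C := le_trans (by positivity) (hC 0 ⟨le_rfl, hT₁'.1.le⟩ 0).1
  refine ⟨C, fun s hs x k hk => ?_⟩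
  have hs₁ : s ∈ Icc 0 T₁ := ⟨hs.1, hs.2.trans htT₁⟩
  have hsT : s ∈ Ico 0 T := ⟨hs.1, (hs.2.trans htT₁).trans_lt hT₁'.2⟩
  have hsmooth : ContDiff ℝ ∞ (u s) := hcl.contDiff_velocity hsT
  obtain ⟨h0, h1, h2, h3⟩ := hC s hs₁ x
  have hw : 0 < (1 + ‖x‖) ^ 3 := by positivity
  -- the weighted operator norm from unit vectors
  have key : ∀ {j : ℕ} (M : ContinuousMultilinearMap ℝ (fun _ : Fin j => EuclideanSpace ℝ (Fin 3))
      (EuclideanSpace ℝ (Fin 3))),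
      (∀ m : Fin j → EuclideanSpace ℝ (Fin 3), (∀ i, ‖m i‖ = 1) → (1 + ‖x‖) ^ 3 * ‖M m‖ ≤ C) →
      (1 + ‖x‖) ^ 3 * ‖M‖ ≤ C := by
    intro j M hM
    have h := decay_opNorm_le_of_unit M (div_nonneg hC0 hw.le) fun m hm => by
      rw [le_div_iff₀ hw, mul_comm]; exact hM m hm
    rwa [le_div_iff₀ hw, mul_comm] at h
  interval_cases k
  · rw [norm_iteratedFDeriv_zero]; exact h0
  · refine key _ fun m hm => ?_
    rw [iteratedFDeriv_one_apply]
    exact h1 (m 0) (hm 0).le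
  · refine key _ fun m hm => ?_
    rw [decay_iteratedFDeriv_two_apply hsmooth]
    exact h2 (m 1) (m 0) (hm 1).le (hm 0).le
  · refine key _ fun m hm => ?_
    rw [decay_iteratedFDeriv_three_apply hsmooth]
    exact h3 (m 2) (m 1) (m 0) (hm 2).le (hm 1).le (hm 0).le

end Summit.NavierStokesRegularity.NavierStokesRegularity.Theorems.SlicedKelvinPlanarFluxAPriori

end
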